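import Mathlib
import Summits.NavierStokesRegularity.NavierStokesRegularity.Theorems.TaoLadderRungTwoBreakBlowupRigidityOneFiniteDepth
import Summits.NavierStokesRegularity.NavierStokesRegularity.Theses.TaoLadderRungTwoBreak
import HarnessLib

/-!
# The OUTFLOW-LIVE CORE normal form, I: a robust blow-up forces a self-sustaining core of modes that EMITS INTO ITSELF
  (some `α_{jk i,(0,0,1)} ≠ 0` with `j, k, i` all in the core) — the common sharpening of the nilpotent /
  outflow-free / one-hop / finite-depth corners of K2(1) `TaoLadderRungTwoBreak.BlowupRigidityOne`
  (stmt-NavierStokesRegularity-20206; `--supports`; the census item (RP′) «core + live cross outflow inside C»)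

MODEL lattice ODEs only (Tao 2016 §4 (4.1)–(4.3), Lemma 4.1 (4.5)–(4.8), Thm. 4.2 statement shape, §5 p. 25); nothing
here is a statement about the Navier–Stokes equations; NO item is closed.  DEF-FREE; ROUTE-INDEPENDENT except for the
two by-name normal forms at the end.  Pure combinatorics of the structure constants plus `…FiniteDepth`.

THE DICHOTOMY (`outflowCore_or_peelable`).  Let `C⋆` be the union of all self-sustaining cores of the table (a core
again).  Either `C⋆` contains an internal outflow monomial (`α_{jk i,(0,0,1)} ≠ 0`, `j, k, i ∈ C⋆`: an OUTFLOW-LIVE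
CORE), or the table is PEELABLE DOWN TO A NON-EMITTING SET: there are a set `C` and a ranking `rank` of the modes with
  (P)  every driver of a mode `i ∉ C` (any shift `μ ∈ S`) has an input `∉ C` of rank `< rank i`
       (`peelableOn_of_no_core_off`: relative peeling off `C⋆`);
  (E)  `α_{jk i,(0,0,1)} = 0` for `j, k, i ∈ C`.
(P) makes `C` CLOSED — drivers from `C × C` land in `C` (`mem_of_peelable`) — so with (E) a `C`-supported shell does
not emit at all (`outflow_eq_zero_of_peelable`); `C = ∅` is the nilpotent class of `…NilpotentTables`, `C = univ` the
outflow-free class of `…VoidTables`; a rotor core fed only by outflow keyed on an undriven mode is peelable but neither.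

* `supportChain_of_peelable` — under (P) + (E), `D n := C ∪ {i ∉ C : n ≤ rank i}` (`n ≤ K := sup rank + 1`),
  `D n := ∅` beyond, is a support chain of `…FiniteDepth` with `D 0 = univ`, `D (K+1) = ∅`: an upward hop, a rotor
  or a back-reaction monomial landing outside `C` raises the rank above that of an input outside `C`, and the top
  level `D K = C` does not emit;
* `not_noGlobalCascade_of_peelable` — hence NO ROBUST BLOW-UP from any one-shell datum at any `ε₀ > 0` on a peelable
  table of `E₂(R)` (global exact flow of depth `≤ m`, `not_noGlobalCascade_of_supportChain_univ`);
* `outflowCore_of_noGlobalCascade` — NUMBER FOR THE CENSUS: a robust blow-up forces an outflow-live core; by name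
  `blowupRigidityOne_iff_outflowCore`, `target_iff_outflowCore` (K2(1) and the rung leaf need only be proved on
  tables with an outflow-live core).  Part II (`…OutflowCoreEternal`) does the same for admissible eternal solutions
  and DSS waves.

HONEST LABEL: bookkeeping normal form for the planner (where any proof or refutation of K2(1) / the rung leaf must
work), strictly containing the nilpotent and void corners; no stub, crux, rung or summit is proved; rung 0.
-/

noncomputable section

-- the summit and its single sub-problem share the name (CONVENTIONS §1)
set_option linter.dupNamespace false

open Set Filter Topology MeasureTheory
open scoped RealInnerProductSpace

namespace Summit.NavierStokesRegularity.NavierStokesRegularity.Theorems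

namespace BlowupRigidityOne

open Literature.Analysis.FluidPDE Literature.Analysis.FluidPDE.TaoCascade
  Literature.Analysis.FluidPDE.Tao2016AveragedNS

variable {m : ℕ} {R ε₀ : ℝ} {α : Fin m → Fin m → Fin m → ℤ × ℤ × ℤ → ℝ}

/-! ## Combinatorics: outflow-live core or peelable -/

/-- **RELATIVE PEELING.**  Fix a set `C` of modes.  If every non-empty set `D` disjoint from `C` contains a mode with no
driver from `(D ∪ C) × (D ∪ C)`, then every `S` disjoint from `C` admits a ranking such that every driver of a mode
`i ∈ S` with inputs in `S ∪ C` has an input in `S` of rank below `rank i` (induction on `S`: rank the undriven mode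
lowest, lift the rest).
[cite: Tao2016AveragedNS, §4 (4.1); cell vocabulary (self-sustaining core, relative nilpotent ranking)] -/
theorem peelableOn_of_no_core_off (C : Finset (Fin m))
    (hno : ∀ D : Finset (Fin m), D.Nonempty → Disjoint D C →
      ∃ i ∈ D, ∀ μ ∈ shiftSet, ∀ j ∈ D ∪ C, ∀ k ∈ D ∪ C, α j k i μ = 0)
    (S : Finset (Fin m)) (hS : Disjoint S C) :
    ∃ rank : Fin m → ℕ, ∀ μ ∈ shiftSet, ∀ i ∈ S, ∀ j ∈ S ∪ C, ∀ k ∈ S ∪ C,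
      α j k i μ ≠ 0 → (j ∈ S ∧ rank j < rank i) ∨ (k ∈ S ∧ rank k < rank i) := by
  classical
  induction S using Finset.strongInduction with
  | H S ih =>
    by_cases hSne : S.Nonempty
    · obtain ⟨i₀, hi₀, hfree⟩ := hno S hSne hS
      have hS' : Disjoint (S.erase i₀) C := Finset.disjoint_of_subset_left (Finset.erase_subset i₀ S) hS
      obtain ⟨r, hr⟩ := ih (S.erase i₀) (Finset.erase_ssubset hi₀) hS'
      refine ⟨fun i => if i = i₀ then 0 else r i + 1, fun μ hμ i hi j hj k hk hne => ?_⟩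
      dsimp only
      by_cases hii : i = i₀
      · subst hii
        exact absurd (hfree μ hμ j hj k hk) hne
      · have hi' : i ∈ S.erase i₀ := Finset.mem_erase.2 ⟨hii, hi⟩
        by_cases hji : j = i₀
        · left
          refine ⟨hji ▸ hi₀, ?_⟩
          rw [if_pos hji, if_neg hii]; exact Nat.succ_pos _
        · by_cases hki : k = i₀
          · right
            refine ⟨hki ▸ hi₀, ?_⟩
            rw [if_pos hki, if_neg hii]; exact Nat.succ_pos _
          · have hj' : j ∈ S.erase i₀ ∪ C := by
              rcases Finset.mem_union.1 hj with h | h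
              · exact Finset.mem_union.2 (Or.inl (Finset.mem_erase.2 ⟨hji, h⟩))
              · exact Finset.mem_union.2 (Or.inr h)
            have hk' : k ∈ S.erase i₀ ∪ C := by
              rcases Finset.mem_union.1 hk with h | h
              · exact Finset.mem_union.2 (Or.inl (Finset.mem_erase.2 ⟨hki, h⟩))
              · exact Finset.mem_union.2 (Or.inr h)
            rcases hr μ hμ i hi' j hj' k hk' hne with ⟨hjS, h⟩ | ⟨hkS, h⟩
            · left
              refine ⟨Finset.mem_of_mem_erase hjS, ?_⟩
              rw [if_neg hji, if_neg hii]; omega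
            · right
              refine ⟨Finset.mem_of_mem_erase hkS, ?_⟩
              rw [if_neg hki, if_neg hii]; omega
    · exact ⟨fun _ => 0, fun μ _ i hi => absurd ⟨i, hi⟩ hSne⟩

/-- **DICHOTOMY: an outflow-live core, or peelable down to a non-emitting closed set.**  For every table, EITHER some
self-sustaining core `C` (every member driven from `C × C`) contains an internal outflow monomial
`α_{jk i,(0,0,1)} ≠ 0`, `j, k, i ∈ C`, OR there are a set `C` and a ranking with (P) every driver of a mode outside `C`
has an input outside `C` of lower rank and (E) no outflow monomial inside `C`.  (Take `C` = the union of all cores.)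
[cite: Tao2016AveragedNS, §4 (4.1); cell vocabulary (self-sustaining core, outflow-live core, peelable table)] -/
theorem outflowCore_or_peelable (α : Fin m → Fin m → Fin m → ℤ × ℤ × ℤ → ℝ) :
    (∃ C : Finset (Fin m), (∀ i ∈ C, ∃ μ ∈ shiftSet, ∃ j ∈ C, ∃ k ∈ C, α j k i μ ≠ 0) ∧
        ∃ i ∈ C, ∃ j ∈ C, ∃ k ∈ C, α j k i ((0 : ℤ), (0 : ℤ), (1 : ℤ)) ≠ 0) ∨
    (∃ (C : Finset (Fin m)) (rank : Fin m → ℕ),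
        (∀ μ ∈ shiftSet, ∀ j k i, i ∉ C → α j k i μ ≠ 0 →
          (j ∉ C ∧ rank j < rank i) ∨ (k ∉ C ∧ rank k < rank i)) ∧
        (∀ i ∈ C, ∀ j ∈ C, ∀ k ∈ C, α j k i ((0 : ℤ), (0 : ℤ), (1 : ℤ)) = 0)) := by
  classical
  -- the union of all cores
  set C : Finset (Fin m) := Finset.univ.filter fun i => ∃ C' : Finset (Fin m), i ∈ C' ∧
    ∀ i' ∈ C', ∃ μ ∈ shiftSet, ∃ j ∈ C', ∃ k ∈ C', α j k i' μ ≠ 0 with hC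
  have hCcore : ∀ i ∈ C, ∃ μ ∈ shiftSet, ∃ j ∈ C, ∃ k ∈ C, α j k i μ ≠ 0 := by
    intro i hi
    rw [hC, Finset.mem_filter] at hi
    obtain ⟨-, C', hiC', hcore'⟩ := hi
    have hsub : C' ⊆ C := by
      intro i' hi'
      rw [hC, Finset.mem_filter]
      exact ⟨Finset.mem_univ _, C', hi', hcore'⟩
    obtain ⟨μ, hμ, j, hj, k, hk, hne⟩ := hcore' i hiC'
    exact ⟨μ, hμ, j, hsub hj, k, hsub hk, hne⟩
  by_cases hout : ∃ i ∈ C, ∃ j ∈ C, ∃ k ∈ C, α j k i ((0 : ℤ), (0 : ℤ), (1 : ℤ)) ≠ 0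
  · exact Or.inl ⟨C, hCcore, hout⟩
  · right
    push Not at hout
    -- relative peeling off `C`
    have hno : ∀ D : Finset (Fin m), D.Nonempty → Disjoint D C →
        ∃ i ∈ D, ∀ μ ∈ shiftSet, ∀ j ∈ D ∪ C, ∀ k ∈ D ∪ C, α j k i μ = 0 := by
      intro D hD hDC
      by_contra hcon
      push Not at hcon
      -- then `D ∪ C` is a core, so `D ⊆ C`, contradicting disjointness
      have hcore' : ∀ i' ∈ D ∪ C, ∃ μ ∈ shiftSet, ∃ j ∈ D ∪ C, ∃ k ∈ D ∪ C, α j k i' μ ≠ 0 := by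
        intro i' hi'
        rcases Finset.mem_union.1 hi' with h | h
        · exact hcon i' h
        · obtain ⟨μ, hμ, j, hj, k, hk, hne⟩ := hCcore i' h
          exact ⟨μ, hμ, j, Finset.mem_union_right _ hj, k, Finset.mem_union_right _ hk, hne⟩
      obtain ⟨i₀, hi₀⟩ := hD
      have hi₀C : i₀ ∈ C := by
        rw [hC, Finset.mem_filter]
        exact ⟨Finset.mem_univ _, D ∪ C, Finset.mem_union_left _ hi₀, hcore'⟩
      exact Finset.disjoint_left.1 hDC hi₀ hi₀C
    obtain ⟨rank, hr⟩ := peelableOn_of_no_core_off C hno (Finset.univ \ C) Finset.sdiff_disjoint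
    refine ⟨C, rank, fun μ hμ j k i hi hne => ?_, hout⟩
    have hiS : i ∈ Finset.univ \ C := Finset.mem_sdiff.2 ⟨Finset.mem_univ _, hi⟩
    have huniv : ∀ l : Fin m, l ∈ (Finset.univ \ C) ∪ C := by
      intro l
      rw [Finset.mem_union]
      by_cases h : l ∈ C
      · exact Or.inr h
      · exact Or.inl (Finset.mem_sdiff.2 ⟨Finset.mem_univ _, h⟩)
    rcases hr μ hμ i hiS j (huniv j) k (huniv k) hne with ⟨hj, h⟩ | ⟨hk, h⟩
    · exact Or.inl ⟨(Finset.mem_sdiff.1 hj).2, h⟩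
    · exact Or.inr ⟨(Finset.mem_sdiff.1 hk).2, h⟩

/-- Under (P) the set `C` is CLOSED: a monomial with both inputs in `C` outputs in `C`.
[cite: Tao2016AveragedNS, §4 (4.1); cell vocabulary (peelable table)] -/
theorem mem_of_peelable {C : Finset (Fin m)} {rank : Fin m → ℕ}
    (hpeel : ∀ μ ∈ shiftSet, ∀ j k i, i ∉ C → α j k i μ ≠ 0 →
      (j ∉ C ∧ rank j < rank i) ∨ (k ∉ C ∧ rank k < rank i))
    {μ : ℤ × ℤ × ℤ} (hμ : μ ∈ shiftSet) {j k i : Fin m} (hj : j ∈ C) (hk : k ∈ C) (hne : α j k i μ ≠ 0) :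
    i ∈ C := by
  by_contra hi
  rcases hpeel μ hμ j k i hi hne with ⟨h, -⟩ | ⟨h, -⟩
  · exact h hj
  · exact h hk

/-- Under (P) + (E) a `C`-supported shell does not emit: `α_{jk i,(0,0,1)} = 0` for `j, k ∈ C` and EVERY `i`.
[cite: Tao2016AveragedNS, §4 (4.1); cell vocabulary (peelable table)] -/
theorem outflow_eq_zero_of_peelable {C : Finset (Fin m)} {rank : Fin m → ℕ}
    (hpeel : ∀ μ ∈ shiftSet, ∀ j k i, i ∉ C → α j k i μ ≠ 0 →
      (j ∉ C ∧ rank j < rank i) ∨ (k ∉ C ∧ rank k < rank i))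
    (hemit : ∀ i ∈ C, ∀ j ∈ C, ∀ k ∈ C, α j k i ((0 : ℤ), (0 : ℤ), (1 : ℤ)) = 0) :
    ∀ j k i, j ∈ C → k ∈ C → α j k i ((0 : ℤ), (0 : ℤ), (1 : ℤ)) = 0 := by
  intro j k i hj hk
  by_contra hne
  have h001 : ((0 : ℤ), (0 : ℤ), (1 : ℤ)) ∈ shiftSet := by simp [shiftSet]
  exact hne (hemit i (mem_of_peelable hpeel h001 hj hk hne) j hj k hk)

/-! ## Peelable tables have a finite support chain: no robust blow-up -/

/-- **THE RELATIVE RANK FILTRATION IS A SUPPORT CHAIN.**  Under (P) + (E), with `K := sup rank + 1`, the sets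
`D n := C ∪ {i ∉ C : n ≤ rank i}` for `n ≤ K` and `D n := ∅` for `n > K` satisfy `D 0 = univ`, `D (K+1) = ∅` and the
chain conditions (O), (A), (B) of `…FiniteDepth`: an outflow / rotor / back-reaction monomial with inputs in the chain
either outputs in `C` or outputs a mode outside `C` of rank above an input outside `C`; at the top level `D K = C` does
not emit by (E) and closedness.
[cite: Tao2016AveragedNS, §4 (4.1); cell vocabulary (support chain, peelable table)] -/
theorem supportChain_of_peelable {C : Finset (Fin m)} {rank : Fin m → ℕ}
    (hpeel : ∀ μ ∈ shiftSet, ∀ j k i, i ∉ C → α j k i μ ≠ 0 →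
      (j ∉ C ∧ rank j < rank i) ∨ (k ∉ C ∧ rank k < rank i))
    (hemit : ∀ i ∈ C, ∀ j ∈ C, ∀ k ∈ C, α j k i ((0 : ℤ), (0 : ℤ), (1 : ℤ)) = 0) :
    ∃ (K : ℕ) (D : ℕ → Finset (Fin m)), D 0 = Finset.univ ∧ D (K + 1) = ∅ ∧
      (∀ n j k i, j ∈ D n → k ∈ D n → i ∉ D (n + 1) → α j k i ((0 : ℤ), (0 : ℤ), (1 : ℤ)) = 0) ∧
      (∀ n j k i, j ∈ D n → k ∈ D n → i ∉ D n → α j k i ((0 : ℤ), (0 : ℤ), (0 : ℤ)) = 0) ∧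
      (∀ n j k i, j ∈ D (n + 1) → k ∈ D n → i ∉ D n →
        α j k i ((1 : ℤ), (0 : ℤ), (0 : ℤ)) = 0 ∧ α k j i ((0 : ℤ), (1 : ℤ), (0 : ℤ)) = 0) := by
  classical
  have h001 : ((0 : ℤ), (0 : ℤ), (1 : ℤ)) ∈ shiftSet := by simp [shiftSet]
  have h000 : ((0 : ℤ), (0 : ℤ), (0 : ℤ)) ∈ shiftSet := by simp [shiftSet]
  have h100 : ((1 : ℤ), (0 : ℤ), (0 : ℤ)) ∈ shiftSet := by simp [shiftSet]
  have h010 : ((0 : ℤ), (1 : ℤ), (0 : ℤ)) ∈ shiftSet := by simp [shiftSet]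
  set K : ℕ := Finset.univ.sup rank + 1 with hK
  have hrank : ∀ i, rank i < K := fun i =>
    Nat.lt_succ_of_le (Finset.le_sup (f := rank) (Finset.mem_univ i))
  set D : ℕ → Finset (Fin m) := fun n =>
    if n ≤ K then C ∪ Finset.univ.filter (fun i => i ∉ C ∧ n ≤ rank i) else ∅ with hD
  -- membership in the chain
  have memD : ∀ n i, i ∈ D n ↔ n ≤ K ∧ (i ∈ C ∨ (i ∉ C ∧ n ≤ rank i)) := by
    intro n i
    rw [hD]
    dsimp only
    by_cases hn : n ≤ K
    · rw [if_pos hn]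
      simp only [Finset.mem_union, Finset.mem_filter, Finset.mem_univ, true_and]
      exact ⟨fun h => ⟨hn, h⟩, fun h => h.2⟩
    · rw [if_neg hn]
      simp only [Finset.notMem_empty, false_iff, not_and]
      exact fun h => absurd h hn
  -- an input of the chain outside `C` has rank `≥ n`
  have rank_ge : ∀ n l, l ∈ D n → l ∉ C → n ≤ rank l := by
    intro n l hl hlC
    rcases ((memD n l).1 hl).2 with h | h
    · exact absurd h hlC
    · exact h.2
  refine ⟨K, D, ?_, ?_, ?_, ?_, ?_⟩
  · ext i
    simp only [memD, Finset.mem_univ, iff_true, zero_le, and_true, true_and]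
    exact em _
  · ext i
    simp only [memD, Finset.notMem_empty, iff_false, not_and]
    intro h; omega
  · -- (O)
    intro n j k i hj hk hi
    have hn : n ≤ K := ((memD n j).1 hj).1
    by_contra hne
    by_cases hiC : i ∈ C
    · -- output in `C`: then `n = K` (else `i ∈ D (n+1)`), and `D K = C` does not emit
      rcases Nat.lt_or_ge n K with hlt | hge
      · exact hi ((memD (n + 1) i).2 ⟨hlt, Or.inl hiC⟩)
      · have hnK : n = K := le_antisymm hn hge
        have hjC : j ∈ C := by
          by_contra hjC; have := rank_ge n j hj hjC; have := hrank j; omega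
        have hkC : k ∈ C := by
          by_contra hkC; have := rank_ge n k hk hkC; have := hrank k; omega
        exact hne (hemit i hiC j hjC k hkC)
    · rcases hpeel _ h001 j k i hiC hne with ⟨hjC, hlt⟩ | ⟨hkC, hlt⟩
      · have := rank_ge n j hj hjC; have := hrank i
        exact hi ((memD (n + 1) i).2 ⟨by omega, Or.inr ⟨hiC, by omega⟩⟩)
      · have := rank_ge n k hk hkC; have := hrank i
        exact hi ((memD (n + 1) i).2 ⟨by omega, Or.inr ⟨hiC, by omega⟩⟩)
  · -- (A)
    intro n j k i hj hk hi
    have hn : n ≤ K := ((memD n j).1 hj).1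
    by_contra hne
    by_cases hiC : i ∈ C
    · exact hi ((memD n i).2 ⟨hn, Or.inl hiC⟩)
    · rcases hpeel _ h000 j k i hiC hne with ⟨hjC, hlt⟩ | ⟨hkC, hlt⟩
      · have := rank_ge n j hj hjC
        exact hi ((memD n i).2 ⟨hn, Or.inr ⟨hiC, by omega⟩⟩)
      · have := rank_ge n k hk hkC
        exact hi ((memD n i).2 ⟨hn, Or.inr ⟨hiC, by omega⟩⟩)
  · -- (B)
    intro n j k i hj hk hi
    have hn : n ≤ K := ((memD n k).1 hk).1
    by_cases hiC : i ∈ C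
    · exact absurd ((memD n i).2 ⟨hn, Or.inl hiC⟩) hi
    · constructor
      · by_contra hne
        rcases hpeel _ h100 j k i hiC hne with ⟨hjC, hlt⟩ | ⟨hkC, hlt⟩
        · have := rank_ge (n + 1) j hj hjC
          exact hi ((memD n i).2 ⟨hn, Or.inr ⟨hiC, by omega⟩⟩)
        · have := rank_ge n k hk hkC
          exact hi ((memD n i).2 ⟨hn, Or.inr ⟨hiC, by omega⟩⟩)
      · by_contra hne
        rcases hpeel _ h010 k j i hiC hne with ⟨hkC, hlt⟩ | ⟨hjC, hlt⟩
        · have := rank_ge n k hk hkC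
          exact hi ((memD n i).2 ⟨hn, Or.inr ⟨hiC, by omega⟩⟩)
        · have := rank_ge (n + 1) j hj hjC
          exact hi ((memD n i).2 ⟨hn, Or.inr ⟨hiC, by omega⟩⟩)

/-- **PEELABLE TABLES NEVER BLOW UP ROBUSTLY.**  If `α ∈ E₂(R)` satisfies (P) + (E) for some set `C` and ranking, then
`¬ NoGlobalCascade ε₀ α X₀` for EVERY `ε₀ > 0` and EVERY one-shell datum (`supportChain_of_peelable` +
`not_noGlobalCascade_of_supportChain_univ`): K2(1) and the rung leaf hold there with no threshold (vacuously).
[cite: Tao2016AveragedNS, §4 Thm. 4.2 (statement shape), Lemma 4.1 (4.5)–(4.8), §5 p. 25; cell vocabulary (`NoGlobalCascade`, peelable table)] -/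
theorem not_noGlobalCascade_of_peelable (hε : 0 < ε₀) (hα : InTableClass R α) {C : Finset (Fin m)}
    {rank : Fin m → ℕ}
    (hpeel : ∀ μ ∈ shiftSet, ∀ j k i, i ∉ C → α j k i μ ≠ 0 →
      (j ∉ C ∧ rank j < rank i) ∨ (k ∉ C ∧ rank k < rank i))
    (hemit : ∀ i ∈ C, ∀ j ∈ C, ∀ k ∈ C, α j k i ((0 : ℤ), (0 : ℤ), (1 : ℤ)) = 0) (X₀ : Fin m → ℝ) :
    ¬ NoGlobalCascade ε₀ α X₀ := by
  obtain ⟨K, D, hD0, hDK, hO, hA, hB⟩ := supportChain_of_peelable hpeel hemit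
  exact not_noGlobalCascade_of_supportChain_univ hε hα hD0 hDK hO hA hB X₀

/-- **A ROBUST BLOW-UP FORCES AN OUTFLOW-LIVE CORE.**  If `α ∈ E₂(R)` and `NoGlobalCascade ε₀ α X₀` (`ε₀ > 0`), then
some self-sustaining core `C` of modes (every member driven from `C × C`) contains an internal outflow monomial
`α_{jk i,(0,0,1)} ≠ 0`, `j, k, i ∈ C` — sharpening `core_of_noGlobalCascade` (a rotor core fed only by outflow keyed
on peelable modes never blows up robustly).
[cite: Tao2016AveragedNS, §4 Thm. 4.2 (statement shape); cell vocabulary (`NoGlobalCascade`, outflow-live core)] -/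
theorem outflowCore_of_noGlobalCascade (hε : 0 < ε₀) (hα : InTableClass R α) {X₀ : Fin m → ℝ}
    (hNG : NoGlobalCascade ε₀ α X₀) :
    ∃ C : Finset (Fin m), (∀ i ∈ C, ∃ μ ∈ shiftSet, ∃ j ∈ C, ∃ k ∈ C, α j k i μ ≠ 0) ∧
      ∃ i ∈ C, ∃ j ∈ C, ∃ k ∈ C, α j k i ((0 : ℤ), (0 : ℤ), (1 : ℤ)) ≠ 0 := by
  rcases outflowCore_or_peelable α with h | ⟨C, rank, hpeel, hemit⟩
  · exact h
  · exact absurd hNG (not_noGlobalCascade_of_peelable hε hα hpeel hemit X₀)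

end BlowupRigidityOne

/-! ## By name: K2(1) and the rung leaf live on tables with an outflow-live core -/

namespace BlowupRigidityOne

open Literature.Analysis.FluidPDE Literature.Analysis.FluidPDE.TaoCascade
open Summit.NavierStokesRegularity.NavierStokesRegularity.Theses.TaoLadderRungTwoBreak

/-- **K2(1) ⟺ K2(1) ON TABLES WITH AN OUTFLOW-LIVE CORE.**  `BlowupRigidityOne` is equivalent to the same implication
demanded only of tables carrying a self-sustaining core with an internal outflow monomial: on every other table of
`E₂(R)` there is no robust blow-up at any `ε₀ > 0` (`outflowCore_of_noGlobalCascade`).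
[cite: Tao2016AveragedNS, §4 Thm. 4.2 (statement shape); cell vocabulary (K2(1), outflow-live core)] -/
theorem blowupRigidityOne_iff_outflowCore :
    BlowupRigidityOne ↔
      ∀ R : ℝ, 1 ≤ R → ∃ εs : ℝ, 0 < εs ∧ ∀ ε₀ : ℝ, 0 < ε₀ → ε₀ ≤ εs →
        ∀ (α : Fin 4 → Fin 4 → Fin 4 → ℤ × ℤ × ℤ → ℝ) (X₀ : Fin 4 → ℝ), InTableClass R α →
          (∃ C : Finset (Fin 4), (∀ i ∈ C, ∃ μ ∈ shiftSet, ∃ j ∈ C, ∃ k ∈ C, α j k i μ ≠ 0) ∧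
            ∃ i ∈ C, ∃ j ∈ C, ∃ k ∈ C, α j k i ((0 : ℤ), (0 : ℤ), (1 : ℤ)) ≠ 0) →
          NoGlobalCascade ε₀ α X₀ →
            ∃ (q : ℕ) (π : Equiv.Perm (Fin q)) (T : ℝ) (Φ : Fin q → ℝ → Em 4),
              IsDSSWave ε₀ α π T Φ ∧ Surviving 1 ε₀ T ∧ ∃ r x, Φ r x ≠ 0 := by
  constructor
  · intro h R hR
    obtain ⟨εs, hεs, H⟩ := h R hR
    exact ⟨εs, hεs, fun ε₀ hε hle α X₀ hα _ hNG => H ε₀ hε hle α X₀ hα hNG⟩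
  · intro h R hR
    obtain ⟨εs, hεs, H⟩ := h R hR
    refine ⟨εs, hεs, fun ε₀ hε hle α X₀ hα hNG => H ε₀ hε hle α X₀ hα ?_ hNG⟩
    exact outflowCore_of_noGlobalCascade hε hα hNG

/-- **The rung leaf ⟺ the rung leaf ON TABLES WITH AN OUTFLOW-LIVE CORE.**  `Target` (BP-D-latt) is equivalent to the
same statement demanded only of tables with a self-sustaining core containing an internal outflow monomial.
[cite: Tao2016AveragedNS, §4 Thm. 4.2 (statement shape); cell vocabulary (`Target` = `RungTwoBreakLatt`, outflow-live core)] -/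
theorem target_iff_outflowCore :
    Target ↔
      ∀ R : ℝ, 1 ≤ R → ∃ εR : ℝ, 0 < εR ∧ ∀ ε₀ : ℝ, 0 < ε₀ → ε₀ ≤ εR →
        ∀ (α : Fin 4 → Fin 4 → Fin 4 → ℤ × ℤ × ℤ → ℝ) (X₀ : Fin 4 → ℝ), InTableClass R α →
          (∃ C : Finset (Fin 4), (∀ i ∈ C, ∃ μ ∈ shiftSet, ∃ j ∈ C, ∃ k ∈ C, α j k i μ ≠ 0) ∧
            ∃ i ∈ C, ∃ j ∈ C, ∃ k ∈ C, α j k i ((0 : ℤ), (0 : ℤ), (1 : ℤ)) ≠ 0) →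
          ¬ NoGlobalCascade ε₀ α X₀ := by
  constructor
  · intro h R hR
    obtain ⟨εR, hεR, H⟩ := h R hR
    exact ⟨εR, hεR, fun ε₀ hε hle α X₀ hα _ => H ε₀ hε hle α X₀ hα⟩
  · intro h R hR
    obtain ⟨εR, hεR, H⟩ := h R hR
    refine ⟨εR, hεR, fun ε₀ hε hle α X₀ hα hNG => ?_⟩
    exact H ε₀ hε hle α X₀ hα (outflowCore_of_noGlobalCascade hε hα hNG) hNG

end BlowupRigidityOne

end Summit.NavierStokesRegularity.NavierStokesRegularity.Theorems

end
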